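import Mathlib
import HarnessLib
import Summits.NavierStokesRegularity.NavierStokesRegularity.Theorems.AxisTwistDoorAveragedConeLiouvilleUnitContraction
import Summits.NavierStokesRegularity.NavierStokesRegularity.Theorems.AxisTwistDoorAveragedConeLiouvillePositivityAffine

/-!
# Route `AxisTwistDoor`, crux `AveragedConeLiouville` (stmt-NavierStokesRegularity-26889), line `lrt_shell`, stub (5b)
# `stub_axisHarnackChain` — brick H0: the split of the pure-PDE Harnack chain into the AFFINE COVARIANCE of the
# positivity-propagation fact (brick H2, proved) and the chain proper (5b-ii)

Lei–Ren–Tian, arXiv:2501.08976, Lemma 2.5, remark: "The exact choice of domains in Lemma 2.5 can be rather arbitrary".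
The chain of stub (5b) applies the classical positivity propagation on parabolic cylinders
`(t₀, t₀ + R²T) × B(x₀, R)` of all sizes; `PositivityPropagationFactC` is stated on the unit cylinder.  This file
records

* (the affine covariance `PositivityPropagationFactC → PositivityPropagationAffineC` — positivity propagation on an
  arbitrary cylinder `(t₀, t₀+R²T) × B(x₀,R)` with the same `β` — is PROVED in `…PositivityAffine.lean`, brick H2);
* `AxisHarnackChainA := PositivityPropagationAffineC → (the conclusion of AxisHarnackChain)` — the registered stub
  statement (5b-ii) (size L: LRT pp. 11–12, the chain through `𝒟₁` and along `𝒟₂` with the comparison function of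
  brick H1 `…AxisLift.supersolution_lift` and the radial drift of `…RadialDrift`);
* `axisHarnackChain_of : AxisHarnackChainA → AxisHarnackChain` (glue with brick H2).

Seat ns-atd-p1 (LEAD). WHAT THIS IS NOT: not a statement about Navier–Stokes regularity; (5b-ii) is NOT proved here. Lands `--supports` the crux item as a helper.
-/

noncomputable section

-- the summit and its single sub-problem share the name (CONVENTIONS §1), as in every Theorems file
set_option linter.dupNamespace false

namespace Summit.NavierStokesRegularity.NavierStokesRegularity.Theorems.AxisTwistDoorAveragedConeLiouvilleHarnackDefs

open scoped InnerProductSpace ENNReal Laplacian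
open Set Function MeasureTheory Metric
open Literature.Analysis
open Literature.Analysis.FluidPDE hiding eR
open Summit.NavierStokesRegularity.NavierStokesRegularity.Theorems.AxisTwistDoorAveragedConeLiouvilleDefs
open Summit.NavierStokesRegularity.NavierStokesRegularity.Theorems.AxisTwistDoorAveragedConeLiouvilleUnitContraction
open Summit.NavierStokesRegularity.NavierStokesRegularity.Theorems.AxisTwistDoorAveragedConeLiouvillePositivityAffine

/-- STUB (5b-ii) statement — the HARNACK CHAIN PROPER, given positivity propagation on arbitrary cylinders: for
`Γ` with `AxisCirculationData Γ δ₀ C_d A Γ*`, a level `κ₀` met in every `𝒬(ρ)` and a bound `M` on `𝒬(9/10)`,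
`Γ ≤ M − c(δ₀,C_d,A,κ₀)` on `𝒬(9/20)` (LRT §4 pp. 11–12). -/
def AxisHarnackChainA : Prop :=
  PositivityPropagationAffineC → ∀ (δ₀ Cd A κ₀ : ℝ), 0 < δ₀ → 0 ≤ Cd → 0 ≤ A → 0 < κ₀ →
    ∃ c : ℝ, 0 < c ∧ ∀ (Γ : ℝ → ℝ → ℝ → ℝ) (Γstar M : ℝ), AxisCirculationData Γ δ₀ Cd A Γstar →
      (∀ ρ : ℝ, 0 < ρ → ∃ s r z : ℝ, -ρ ^ 2 < s ∧ s < 0 ∧ 0 < r ∧ r < ρ ∧ |z| < ρ ∧ κ₀ ≤ Γ r z s) →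
      (∀ s r z : ℝ, -(9 / 10) ^ 2 < s → s < 0 → 0 < r → r < 9 / 10 → |z| < 9 / 10 → Γ r z s ≤ M) →
      ∀ s r z : ℝ, -(9 / 20) ^ 2 < s → s < 0 → 0 < r → r < 9 / 20 → |z| < 9 / 20 → Γ r z s ≤ M - c

/-- Glue: the affine covariance (brick H2, proved) and (5b-ii) give (5b). -/
theorem axisHarnackChain_of (h2 : AxisHarnackChainA) : AxisHarnackChain :=
  fun hPos => h2 (positivityPropagationAffine_of_factC hPos)

end Summit.NavierStokesRegularity.NavierStokesRegularity.Theorems.AxisTwistDoorAveragedConeLiouvilleHarnackDefs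

end
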